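import Mathlib

/-!
# SoloBlind artefact 31a — pointwise trigonometric polynomials: closure algebra and division by `1 − cos x`
(`paper/window-height.md` §12.10.3 (i)(a′); support file for `SoloBlindTVReduction` (artefact 31), claims C73, C119)

Context (soloist `solo-RiemannHypothesis-blind`, session s55).  This file is the algebraic half of artefact 31, the
Fejér–Riesz-free reduction of THEOREM K to its circle-rooted case (`SoloBlindTVReduction.lean`).  It works with the
property that `f : ℝ → ℝ` is pointwise a real trigonometric polynomial `Σ_{m ≤ d} (a_m cos(mx) + b_m sin(mx))` of
degree `≤ d` (spelled out as an explicit `∃ ac bc, ∀ y, f y = Σ …` in every statement), proves its closure properties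
(sums, scalars, multiplication by `cos x`, `sin x` and by a root factor `1 − cos(x − θ)`, translation; namespace
`SoloBlindTrigPoly`), and the DIVISION LEMMA `soloBlind_trigPoly_divide`: every `f` of degree `≤ d+1` is
`f(x) = (1 − cos x)·g(x) + α + β·sin x` with `g` of degree `≤ d`.  The quotients `F_m = (1 − cos mx)/(1 − cos x)` and
`G_m = (sin mx − m·sin x)/(1 − cos x)` are trigonometric polynomials of degree `m − 1` (`soloBlind_divQuotients`),
produced two consecutive indices at a time by the recurrences `F_{m+2} = 2cos x·F_{m+1} − F_m + 2`,
`G_{m+2} = 2cos x·G_{m+1} − G_m − 2(m+1)·sin x`; the defining identities follow from the addition formulas by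
`linear_combination`.
Mathlib only; no sorries; no new definitions.
-/

open Finset Real

namespace Summit.RiemannHypothesis.RiemannHypothesis.Theorems

/-! Throughout, "`f` is a trigonometric polynomial of degree `≤ d`" is the explicit statement
`∃ ac bc : ℕ → ℝ, ∀ y, f y = ∑ l ∈ range (d + 1), (ac l * cos (l * y) + bc l * sin (l * y))`
(written out in every signature: no definition or notation is introduced). -/

namespace SoloBlindTrigPoly

/-- `cos (j x)` has degree `≤ d` whenever `j ≤ d`. -/
theorem of_cos {d j : ℕ} (hj : j ≤ d) : (∃ ac bc : ℕ → ℝ, ∀ y, (fun x => cos (j * x)) y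
    = ∑ l ∈ range (d + 1), (ac l * cos (l * y) + bc l * sin (l * y))) := by
  refine ⟨fun m => if m = j then 1 else 0, fun _ => 0, fun x => ?_⟩
  have hj' : j ∈ range (d + 1) := mem_range.mpr (Nat.lt_succ_of_le hj)
  rw [Finset.sum_eq_single j]
  · simp
  · intro m _ hm; simp [hm]
  · intro h; exact absurd hj' h

/-- `sin (j x)` has degree `≤ d` whenever `j ≤ d`. -/
theorem of_sin {d j : ℕ} (hj : j ≤ d) : (∃ ac bc : ℕ → ℝ, ∀ y, (fun x => sin (j * x)) y
    = ∑ l ∈ range (d + 1), (ac l * cos (l * y) + bc l * sin (l * y))) := by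
  refine ⟨fun _ => 0, fun m => if m = j then 1 else 0, fun x => ?_⟩
  have hj' : j ∈ range (d + 1) := mem_range.mpr (Nat.lt_succ_of_le hj)
  rw [Finset.sum_eq_single j]
  · simp
  · intro m _ hm; simp [hm]
  · intro h; exact absurd hj' h

/-- Constants have every degree. -/
theorem const (d : ℕ) (c : ℝ) : (∃ ac bc : ℕ → ℝ, ∀ y, (fun _ => c) y
    = ∑ l ∈ range (d + 1), (ac l * cos (l * y) + bc l * sin (l * y))) := by
  refine ⟨fun m => if m = 0 then c else 0, fun _ => 0, fun x => ?_⟩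
  rw [Finset.sum_eq_single 0]
  · simp
  · intro m _ hm; simp [hm]
  · intro h; exact absurd (mem_range.mpr (Nat.succ_pos d)) h

/-- The zero function has every degree. -/
theorem zero (d : ℕ) : (∃ ac bc : ℕ → ℝ, ∀ y, (fun _ => 0) y
    = ∑ l ∈ range (d + 1), (ac l * cos (l * y) + bc l * sin (l * y))) := const d 0

/-- Closure under addition. -/
theorem add {d : ℕ} {f g : ℝ → ℝ} (hf : (∃ ac bc : ℕ → ℝ, ∀ y, f y
    = ∑ l ∈ range (d + 1), (ac l * cos (l * y) + bc l * sin (l * y)))) (hg : (∃ ac bc : ℕ → ℝ, ∀ y,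
    g y = ∑ l ∈ range (d + 1), (ac l * cos (l * y) + bc l * sin (l * y)))) :
    (∃ ac bc : ℕ → ℝ, ∀ y, (fun x => f x + g x) y
        = ∑ l ∈ range (d + 1), (ac l * cos (l * y) + bc l * sin (l * y))) := by
  obtain ⟨a, b, hf⟩ := hf
  obtain ⟨a', b', hg⟩ := hg
  refine ⟨fun m => a m + a' m, fun m => b m + b' m, fun x => ?_⟩
  show f x + g x = _
  rw [hf x, hg x, ← Finset.sum_add_distrib]
  exact Finset.sum_congr rfl fun m _ => by ring

/-- Closure under scalar multiplication. -/
theorem smul {d : ℕ} {f : ℝ → ℝ} (c : ℝ) (hf : (∃ ac bc : ℕ → ℝ, ∀ y, f y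
    = ∑ l ∈ range (d + 1), (ac l * cos (l * y) + bc l * sin (l * y)))) :
    (∃ ac bc : ℕ → ℝ, ∀ y, (fun x => c * f x) y
        = ∑ l ∈ range (d + 1), (ac l * cos (l * y) + bc l * sin (l * y))) := by
  obtain ⟨a, b, hf⟩ := hf
  refine ⟨fun m => c * a m, fun m => c * b m, fun x => ?_⟩
  show c * f x = _
  rw [hf x, Finset.mul_sum]
  exact Finset.sum_congr rfl fun m _ => by ring

/-- Closure under negation. -/
theorem neg {d : ℕ} {f : ℝ → ℝ} (hf : (∃ ac bc : ℕ → ℝ, ∀ y, f y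
    = ∑ l ∈ range (d + 1), (ac l * cos (l * y) + bc l * sin (l * y)))) :
    (∃ ac bc : ℕ → ℝ, ∀ y, (fun x => -f x) y = ∑ l ∈ range (d + 1), (ac l * cos (l * y) + bc l * sin (l * y))) := by
  have e : (fun x => -f x) = fun x => (-1) * f x := by funext x; ring
  rw [e]; exact smul (-1) hf

/-- Closure under subtraction. -/
theorem sub {d : ℕ} {f g : ℝ → ℝ} (hf : (∃ ac bc : ℕ → ℝ, ∀ y, f y
    = ∑ l ∈ range (d + 1), (ac l * cos (l * y) + bc l * sin (l * y)))) (hg : (∃ ac bc : ℕ → ℝ, ∀ y,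
    g y = ∑ l ∈ range (d + 1), (ac l * cos (l * y) + bc l * sin (l * y)))) :
    (∃ ac bc : ℕ → ℝ, ∀ y, (fun x => f x - g x) y
        = ∑ l ∈ range (d + 1), (ac l * cos (l * y) + bc l * sin (l * y))) := by
  have e : (fun x => f x - g x) = fun x => f x + (-g x) := by funext x; ring
  rw [e]; exact add hf (neg hg)

/-- The degree bound may be raised. -/
theorem mono {d d' : ℕ} (hdd : d ≤ d') {f : ℝ → ℝ} (hf : (∃ ac bc : ℕ → ℝ, ∀ y, f y
    = ∑ l ∈ range (d + 1), (ac l * cos (l * y) + bc l * sin (l * y)))) :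
    (∃ ac bc : ℕ → ℝ, ∀ y, f y = ∑ l ∈ range (d' + 1), (ac l * cos (l * y) + bc l * sin (l * y))) := by
  obtain ⟨a, b, hf⟩ := hf
  refine ⟨fun m => if m ≤ d then a m else 0, fun m => if m ≤ d then b m else 0, fun x => ?_⟩
  rw [hf x]
  have hsub : range (d + 1) ⊆ range (d' + 1) := range_subset_range.mpr (by omega)
  rw [← Finset.sum_subset hsub]
  · refine Finset.sum_congr rfl fun m hm => ?_
    have : m ≤ d := Nat.lt_succ_iff.mp (mem_range.mp hm)
    simp [this]
  · intro m _ hm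
    have : ¬ m ≤ d := fun h => hm (mem_range.mpr (Nat.lt_succ_of_le h))
    simp [this]

/-- Closure under finite sums. -/
theorem sum {d : ℕ} {ι : Type*} (s : Finset ι) (F : ι → ℝ → ℝ)
    (h : ∀ i ∈ s, (∃ ac bc : ℕ → ℝ, ∀ y, (F i) y
        = ∑ l ∈ range (d + 1), (ac l * cos (l * y) + bc l * sin (l * y)))) :
    (∃ ac bc : ℕ → ℝ, ∀ y, (fun x => ∑ i ∈ s, F i x) y
        = ∑ l ∈ range (d + 1), (ac l * cos (l * y) + bc l * sin (l * y))) := by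
  classical
  induction s using Finset.induction_on with
  | empty => simpa using zero d
  | insert i s hi ih =>
    have h1 : (∃ ac bc : ℕ → ℝ, ∀ y, (F i) y
        = ∑ l ∈ range (d + 1), (ac l * cos (l * y) + bc l * sin (l * y))) := h i (mem_insert_self i s)
    have h2 := ih fun j hj => h j (mem_insert_of_mem hj)
    have e : (fun x => ∑ j ∈ insert i s, F j x) = fun x => F i x + ∑ j ∈ s, F j x := by
      funext x; rw [Finset.sum_insert hi]
    rw [e]; exact add h1 h2

/-- `cos x · cos(mx)` has degree `≤ m + 1`. -/
theorem cos_mul_cos (m : ℕ) : (∃ ac bc : ℕ → ℝ, ∀ y, (fun x => cos x * cos (m * x)) y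
    = ∑ l ∈ range (m + 1 + 1), (ac l * cos (l * y) + bc l * sin (l * y))) := by
  rcases m with _ | k
  · have : (fun x : ℝ => cos x * cos ((0:ℕ) * x)) = fun x => cos ((1:ℕ) * x) := by
      funext x; simp
    rw [this]; exact of_cos le_rfl
  · have key : (fun x : ℝ => cos x * cos ((k + 1 : ℕ) * x))
        = fun x => (1/2) * cos ((k + 2 : ℕ) * x) + (1/2) * cos (k * x) := by
      funext x
      have h1 : ((k + 2 : ℕ) : ℝ) * x = (k + 1 : ℕ) * x + x := by push_cast; ring
      have h2 : (k : ℝ) * x = (k + 1 : ℕ) * x - x := by push_cast; ring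
      rw [h1, h2, cos_add, cos_sub]; ring
    rw [key]
    exact add (smul _ (of_cos le_rfl)) (smul _ (of_cos (by omega)))

/-- `cos x · sin(mx)` has degree `≤ m + 1`. -/
theorem cos_mul_sin (m : ℕ) : (∃ ac bc : ℕ → ℝ, ∀ y, (fun x => cos x * sin (m * x)) y
    = ∑ l ∈ range (m + 1 + 1), (ac l * cos (l * y) + bc l * sin (l * y))) := by
  rcases m with _ | k
  · have : (fun x : ℝ => cos x * sin ((0:ℕ) * x)) = fun _ => 0 := by
      funext x; simp
    rw [this]; exact zero _
  · have key : (fun x : ℝ => cos x * sin ((k + 1 : ℕ) * x))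
        = fun x => (1/2) * sin ((k + 2 : ℕ) * x) + (1/2) * sin (k * x) := by
      funext x
      have h1 : ((k + 2 : ℕ) : ℝ) * x = (k + 1 : ℕ) * x + x := by push_cast; ring
      have h2 : (k : ℝ) * x = (k + 1 : ℕ) * x - x := by push_cast; ring
      rw [h1, h2, sin_add, sin_sub]; ring
    rw [key]
    exact add (smul _ (of_sin le_rfl)) (smul _ (of_sin (by omega)))

/-- `sin x · cos(mx)` has degree `≤ m + 1`. -/
theorem sin_mul_cos (m : ℕ) : (∃ ac bc : ℕ → ℝ, ∀ y, (fun x => sin x * cos (m * x)) y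
    = ∑ l ∈ range (m + 1 + 1), (ac l * cos (l * y) + bc l * sin (l * y))) := by
  rcases m with _ | k
  · have : (fun x : ℝ => sin x * cos ((0:ℕ) * x)) = fun x => sin ((1:ℕ) * x) := by
      funext x; simp
    rw [this]; exact of_sin le_rfl
  · have key : (fun x : ℝ => sin x * cos ((k + 1 : ℕ) * x))
        = fun x => (1/2) * sin ((k + 2 : ℕ) * x) + (-(1/2)) * sin (k * x) := by
      funext x
      have h1 : ((k + 2 : ℕ) : ℝ) * x = (k + 1 : ℕ) * x + x := by push_cast; ring
      have h2 : (k : ℝ) * x = (k + 1 : ℕ) * x - x := by push_cast; ring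
      rw [h1, h2, sin_add, sin_sub]; ring
    rw [key]
    exact add (smul _ (of_sin le_rfl)) (smul _ (of_sin (by omega)))

/-- `sin x · sin(mx)` has degree `≤ m + 1`. -/
theorem sin_mul_sin (m : ℕ) : (∃ ac bc : ℕ → ℝ, ∀ y, (fun x => sin x * sin (m * x)) y
    = ∑ l ∈ range (m + 1 + 1), (ac l * cos (l * y) + bc l * sin (l * y))) := by
  rcases m with _ | k
  · have : (fun x : ℝ => sin x * sin ((0:ℕ) * x)) = fun _ => 0 := by
      funext x; simp
    rw [this]; exact zero _
  · have key : (fun x : ℝ => sin x * sin ((k + 1 : ℕ) * x))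
        = fun x => (-(1/2)) * cos ((k + 2 : ℕ) * x) + (1/2) * cos (k * x) := by
      funext x
      have h1 : ((k + 2 : ℕ) : ℝ) * x = (k + 1 : ℕ) * x + x := by push_cast; ring
      have h2 : (k : ℝ) * x = (k + 1 : ℕ) * x - x := by push_cast; ring
      rw [h1, h2, cos_add, cos_sub]; ring
    rw [key]
    exact add (smul _ (of_cos le_rfl)) (smul _ (of_cos (by omega)))

/-- Multiplication by `cos x` raises the degree by one. -/
theorem mul_cos {d : ℕ} {f : ℝ → ℝ} (hf : (∃ ac bc : ℕ → ℝ, ∀ y, f y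
    = ∑ l ∈ range (d + 1), (ac l * cos (l * y) + bc l * sin (l * y)))) :
    (∃ ac bc : ℕ → ℝ, ∀ y, (fun x => cos x * f x) y
        = ∑ l ∈ range (d + 1 + 1), (ac l * cos (l * y) + bc l * sin (l * y))) := by
  obtain ⟨a, b, hf⟩ := hf
  have key : (fun x => cos x * f x)
      = fun x => ∑ m ∈ range (d + 1), (a m * (cos x * cos (m * x)) + b m * (cos x * sin (m * x))) := by
    funext x; rw [hf x, Finset.mul_sum]
    exact Finset.sum_congr rfl fun m _ => by ring
  rw [key]
  refine sum _ _ fun m hm => ?_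
  have hm' : m + 1 ≤ d + 1 := by have := mem_range.mp hm; omega
  exact add (smul _ (mono hm' (cos_mul_cos m))) (smul _ (mono hm' (cos_mul_sin m)))

/-- Multiplication by `sin x` raises the degree by one. -/
theorem mul_sin {d : ℕ} {f : ℝ → ℝ} (hf : (∃ ac bc : ℕ → ℝ, ∀ y, f y
    = ∑ l ∈ range (d + 1), (ac l * cos (l * y) + bc l * sin (l * y)))) :
    (∃ ac bc : ℕ → ℝ, ∀ y, (fun x => sin x * f x) y
        = ∑ l ∈ range (d + 1 + 1), (ac l * cos (l * y) + bc l * sin (l * y))) := by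
  obtain ⟨a, b, hf⟩ := hf
  have key : (fun x => sin x * f x)
      = fun x => ∑ m ∈ range (d + 1), (a m * (sin x * cos (m * x)) + b m * (sin x * sin (m * x))) := by
    funext x; rw [hf x, Finset.mul_sum]
    exact Finset.sum_congr rfl fun m _ => by ring
  rw [key]
  refine sum _ _ fun m hm => ?_
  have hm' : m + 1 ≤ d + 1 := by have := mem_range.mp hm; omega
  exact add (smul _ (mono hm' (sin_mul_cos m))) (smul _ (mono hm' (sin_mul_sin m)))

/-- Multiplication by the root factor `1 − cos(x − θ)` raises the degree by one. -/
theorem mul_rootFactor {d : ℕ} {f : ℝ → ℝ} (hf : (∃ ac bc : ℕ → ℝ, ∀ y, f y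
    = ∑ l ∈ range (d + 1), (ac l * cos (l * y) + bc l * sin (l * y)))) (θ : ℝ) :
    (∃ ac bc : ℕ → ℝ, ∀ y, (fun x => (1 - cos (x - θ)) * f x) y
        = ∑ l ∈ range (d + 1 + 1), (ac l * cos (l * y) + bc l * sin (l * y))) := by
  have key : (fun x => (1 - cos (x - θ)) * f x)
      = fun x => (f x + (-cos θ) * (cos x * f x)) + (-sin θ) * (sin x * f x) := by
    funext x; rw [cos_sub]; ring
  rw [key]
  exact add (add (mono (Nat.le_succ d) hf) (smul _ (mul_cos hf))) (smul _ (mul_sin hf))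

/-- Translation invariance. -/
theorem translate {d : ℕ} {f : ℝ → ℝ} (hf : (∃ ac bc : ℕ → ℝ, ∀ y, f y
    = ∑ l ∈ range (d + 1), (ac l * cos (l * y) + bc l * sin (l * y)))) (c : ℝ) :
    (∃ ac bc : ℕ → ℝ, ∀ y, (fun x => f (x + c)) y
        = ∑ l ∈ range (d + 1), (ac l * cos (l * y) + bc l * sin (l * y))) := by
  obtain ⟨a, b, hf⟩ := hf
  refine ⟨fun m => a m * cos (m * c) + b m * sin (m * c),
    fun m => -(a m * sin (m * c)) + b m * cos (m * c), fun x => ?_⟩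
  show f (x + c) = _
  rw [hf (x + c)]
  refine Finset.sum_congr rfl fun m _ => ?_
  rw [mul_add, cos_add, sin_add]; ring

end SoloBlindTrigPoly

open SoloBlindTrigPoly

/-! ### Division by `1 - cos x`

The quotients `F_m = (1 - cos mx)/(1 - cos x)` and `G_m = (sin mx - m·sin x)/(1 - cos x)` are trigonometric
polynomials of degree `m - 1`; they are produced two consecutive indices at a time by the three-term recurrences
`F_{m+2} = 2cos x·F_{m+1} - F_m + 2`, `G_{m+2} = 2cos x·G_{m+1} - G_m - 2(m+1)·sin x`. -/

/-- The quotients of `1 - cos(mx)`, `1 - cos((m+1)x)`, `sin(mx) - m sin x`, `sin((m+1)x) - (m+1) sin x` by `1 - cos x`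
exist as trigonometric polynomials of degrees `≤ m - 1, m, m - 1, m`. -/
theorem soloBlind_divQuotients : ∀ m : ℕ, ∃ F₀ F₁ G₀ G₁ : ℝ → ℝ,
    (∃ ac bc : ℕ → ℝ, ∀ y, F₀ y
        = ∑ l ∈ range (m - 1 + 1), (ac l * cos (l * y) + bc l * sin (l * y))) ∧ (∃ ac bc : ℕ → ℝ, ∀ y,
        F₁ y = ∑ l ∈ range (m + 1), (ac l * cos (l * y) + bc l * sin (l * y))) ∧ (∃ ac bc : ℕ → ℝ, ∀ y,
        G₀ y = ∑ l ∈ range (m - 1 + 1), (ac l * cos (l * y) + bc l * sin (l * y))) ∧ (∃ ac bc : ℕ → ℝ, ∀ y,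
        G₁ y = ∑ l ∈ range (m + 1), (ac l * cos (l * y) + bc l * sin (l * y))) ∧
    (∀ x, (1 - cos x) * F₀ x = 1 - cos (m * x)) ∧ (∀ x, (1 - cos x) * F₁ x = 1 - cos ((m + 1 : ℕ) * x)) ∧
    (∀ x, (1 - cos x) * G₀ x = sin (m * x) - m * sin x) ∧
    (∀ x, (1 - cos x) * G₁ x = sin ((m + 1 : ℕ) * x) - (m + 1 : ℕ) * sin x)
  | 0 => ⟨fun _ => 0, fun _ => 1, fun _ => 0, fun _ => 0, zero _, const _ _, zero _, zero _,
      fun x => by simp, fun x => by simp, fun x => by simp, fun x => by simp⟩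
  | (m + 1) => by
    obtain ⟨F₀, F₁, G₀, G₁, hF₀, hF₁, hG₀, hG₁, eF₀, eF₁, eG₀, eG₁⟩ := soloBlind_divQuotients m
    have hs : (∃ ac bc : ℕ → ℝ, ∀ y, (fun x => sin x) y
        = ∑ l ∈ range (m + 1 + 1), (ac l * cos (l * y) + bc l * sin (l * y))) := by
      simpa using (of_sin (d := m + 1) (j := 1) (by omega))
    refine ⟨F₁, fun x => (2 * (cos x * F₁ x) - F₀ x) + 2, G₁,
      fun x => (2 * (cos x * G₁ x) - G₀ x) + (-(2 * ((m : ℝ) + 1))) * sin x, ?_, ?_, ?_, ?_, eF₁, ?_, eG₁, ?_⟩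
    · simpa using hF₁
    · exact add (sub (smul 2 (mul_cos hF₁)) (mono (by omega) hF₀)) (const _ 2)
    · simpa using hG₁
    · exact add (sub (smul 2 (mul_cos hG₁)) (mono (by omega) hG₀)) (smul _ hs)
    · intro x
      have h0 := eF₀ x
      have h1 := eF₁ x
      push_cast at h0 h1 ⊢
      have hc2 : cos (((m : ℝ) + 1 + 1) * x) = cos ((m + 1) * x) * cos x - sin ((m + 1) * x) * sin x := by
        rw [show ((m : ℝ) + 1 + 1) * x = (m + 1) * x + x by ring, cos_add]
      have hc0 : cos ((m : ℝ) * x) = cos ((m + 1) * x) * cos x + sin ((m + 1) * x) * sin x := by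
        rw [show (m : ℝ) * x = (m + 1) * x - x by ring, cos_sub]
      linear_combination (2 * cos x) * h1 - h0 + hc2 + hc0
    · intro x
      have h0 := eG₀ x
      have h1 := eG₁ x
      push_cast at h0 h1 ⊢
      have hs2 : sin (((m : ℝ) + 1 + 1) * x) = sin ((m + 1) * x) * cos x + cos ((m + 1) * x) * sin x := by
        rw [show ((m : ℝ) + 1 + 1) * x = (m + 1) * x + x by ring, sin_add]
      have hs0 : sin ((m : ℝ) * x) = sin ((m + 1) * x) * cos x - cos ((m + 1) * x) * sin x := by
        rw [show (m : ℝ) * x = (m + 1) * x - x by ring, sin_sub]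
      linear_combination (2 * cos x) * h1 - h0 - hs2 - hs0

/-- Division with remainder by `1 - cos x`: the remainders are spanned by `1` and `sin x`. -/
theorem soloBlind_trigPoly_divide {d : ℕ} {f : ℝ → ℝ} (hf : (∃ ac bc : ℕ → ℝ, ∀ y, f y
    = ∑ l ∈ range (d + 1 + 1), (ac l * cos (l * y) + bc l * sin (l * y)))) :
    ∃ g : ℝ → ℝ, ∃ α β : ℝ, (∃ ac bc : ℕ → ℝ, ∀ y, g y
        = ∑ l ∈ range (d + 1), (ac l * cos (l * y) + bc l * sin (l * y))) ∧
      ∀ x, f x = (1 - cos x) * g x + α + β * sin x := by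
  obtain ⟨a, b, hf⟩ := hf
  choose F₀ F₁ G₀ G₁ hF₀ hF₁ hG₀ hG₁ eF₀ eF₁ eG₀ eG₁ using soloBlind_divQuotients
  refine ⟨fun x => ∑ m ∈ range (d + 1 + 1), (-(a m) * F₀ m x + b m * G₀ m x),
    ∑ m ∈ range (d + 1 + 1), a m, ∑ m ∈ range (d + 1 + 1), b m * m, ?_, fun x => ?_⟩
  · refine SoloBlindTrigPoly.sum _ _ fun m hm => add (smul _ ?_) (smul _ ?_)
    · exact mono (by have := mem_range.mp hm; omega) (hF₀ m)
    · exact mono (by have := mem_range.mp hm; omega) (hG₀ m)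
  · rw [hf x, Finset.mul_sum, Finset.sum_mul, ← Finset.sum_add_distrib, ← Finset.sum_add_distrib]
    refine Finset.sum_congr rfl fun m _ => ?_
    have hF := eF₀ m x
    have hG := eG₀ m x
    linear_combination (a m) * hF - (b m) * hG

end Summit.RiemannHypothesis.RiemannHypothesis.Theorems
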